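import Mathlib
import HarnessLib
import Summits.Ventures.LatticeQCDFlow.Exactness.SU2WilsonFlowLOMemberFTHMCN
import Summits.Ventures.LatticeQCDFlow.Exactness.SU2WilsonFlowLOExactForceRegular
import Summits.Ventures.LatticeQCDFlow.Exactness.SU2LeapfrogHMCWilson
import Summits.Ventures.LatticeQCDFlow.Exactness.SU2WilsonFlowLOAcceptanceLattice

/-!
# FT-HMC through the `SU(2)` LO Wilson-flow member WITH THE EXACT AUTODIFF FORCE AS RUN, at every `nstep` below a trajectory-length threshold, converges to the Wilson measure from every start — any torus, any schedule; the row's 4⁴ acceptance configuration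

HONEST FRAMING: exact (Metropolis-corrected) sampling algorithms for lattice gauge theory;
figures of merit are autocorrelation/cost numbers at stated couplings and volumes; no
continuum-physics claim.

Venture `LatticeQCDFlow` (cell pub-lqcd), topic `Exactness`; FANOUT row 14 (`eng-flowhmc`, engine
`latflow.fthmc`, family B; the row's acceptance test: the LO Wilson-flow member inside HMC on the 4⁴
`SU(2)` lattice with the force by autodiff of the pulled-back action, `nstep ≥ 1` leapfrog steps).  NEW
WORK of the cell — the assembly of this generation's chain: `SUNMultiStepLeapfrogFTHMCErgodic`
(`su2LeapfrogFTHMCN_uniformlyErgodic_of_trajLength`: the reported `n`-step kernel through any pinched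
member with ANY measurable bounded Lipschitz force field converges for `nε' ≤ τ₀`),
`SU2WilsonFlowLOMemberFTHMCN` (`su2WilsonFlowLO_member_package`: the LO member's certified layers,
pinched running density, `HasJacobian`), `SU2WilsonFlowLOExactForceRegular`
(`su2WilsonFlowLO_exactForce_regular`: THE EXACT FORCE through the member is measurable, bounded,
Lipschitz), `SU2LeapfrogHMCWilson` (`β S_W` bounded, `su2GibbsLaw = wilsonMeasure`),
`SU2WilsonFlowLOAcceptanceLattice` (`exists_parityMask`, Lüscher's schedule on 4⁴); nothing is cited
as a fact; no number.  Every `SU(2)` field-transformed file of the tree listed "multi-step with the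
force as run" as NOT CLAIMED; here it is, below a threshold.

* **`su2WilsonFlowLO_member_fthmcN_exactForce_uniformlyErgodic`** — torus `(ℤ/L)^d`, proper colouring
  `χ`, `2(d−1)|ε| < 1`, ANY schedule `sched` (layers packaged VERBATIM as in
  `exists_layers_su2WilsonFlowLO`), every `β`, force scale `κ`, kinetic coefficient `κ' > 0`: the exact
  force field `Φ_κ(V)_l = κ·∂_(a_l) S̃((l ↦ expPauli (a l)) * V)|_(a=0)` is measurable, and THERE IS
  `τ₀ > 0` such that for EVERY `n ≥ 1`, `ε' > 0` with `nε' ≤ τ₀`, row 9's `n`-step kernel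
  `su2LeapfrogHMCN ε' κ'` driven by the half kick `−(ε'/2)·Φ_κ` for `S̃ = β S_W∘F − log J`, reported
  through the member `F`, satisfies `|μ₀K̃ᵗ(A) − wilsonMeasure(A)| ≤ (1 − δ)^⌊t/(k+1)⌋` for some `k`,
  `δ ∈ (0, 1]`, EVERY initial law `μ₀`, every `t`, every set `A`;
* `su2LeapfrogFTHMCN_invariant_unique_of_trajLength` (any member, Pauli coordinates) and
  **`wilsonMeasure_unique_invariant_su2WilsonFlowLO_member_fthmcN_exactForce`** — below a threshold the
  Wilson measure is the ONLY invariant probability law of that reported kernel;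
* **`su2_fthmcN_acceptanceLattice_exactForce_uniformlyErgodic`** — THE ROW'S ACCEPTANCE CONFIGURATION:
  4⁴ `SU(2)`, a parity colouring, Lüscher's sweep schedule (`8·nsweeps` masked LO sub-steps), refusal
  rule `6|ε| < 1`, the same conclusion.

NOT CLAIMED: any value of `τ₀`, `k`, `δ` (compactness and the inverse function theorem; `τ₀` depends on
`d, L, β, κ, ε`, the schedule — NOT claimed uniform in the volume); anything for longer trajectories
(the engine's usual `τ ≈ 1` is not covered; Mackenzie 1989); OMF words / `tau_jitter`; the quaternion
drift of GEN-7's kernels (here row 9's Pauli drift `expPauli`, the tree's `n`-step `SU(2)` kernel of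
record); floating-point autodiff; any number — the row's `⟨e^(−ΔH)⟩ = 1` test is MEASURED, not typed.
-/

noncomputable section

namespace Summit.Ventures.LatticeQCDFlow.Exactness

open Set Filter Topology Function MeasureTheory ProbabilityTheory ProbabilityTheory.Kernel InnerProductGeometry
open Literature.MathematicalPhysics.QuantumFieldTheory
open Literature.MathematicalPhysics.QuantumFieldTheory.Balaban1983to89.B10Eq18SigmaSU2Haar (expPauli)
open scoped ENNReal Matrix Matrix.Norms.Operator NNReal

set_option backward.isDefEq.respectTransparency false

/-! ## Uniqueness in trajectory-length form (Pauli coordinates, any member) -/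

section UniqueTraj

variable {ι : Type*} [Fintype ι] {κ' : ℝ}
  {Φ : (ι → Matrix.specialUnitaryGroup (Fin 2) ℂ) → ι → EuclideanSpace ℝ (Fin 3)} {Φmax KΦ : ℝ}
  {S : (ι → Matrix.specialUnitaryGroup (Fin 2) ℂ) → ℝ} {s : ℝ}
  {F : (ι → Matrix.specialUnitaryGroup (Fin 2) ℂ) ≃ᵐ (ι → Matrix.specialUnitaryGroup (Fin 2) ℂ)}
  {J : (ι → Matrix.specialUnitaryGroup (Fin 2) ℂ) → ℝ} {j₁ j₂ : ℝ}

/-- **Uniqueness of the invariant law in trajectory-length form** (the twin of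
`su2LeapfrogFTHMCN_uniformlyErgodic_of_trajLength`): for a measurable force field `Φ` bounded by
`Φ_max` and `K_Φ`-Lipschitz in the matrix sup norm, `κ' > 0`, measurable `|S| ≤ s`, a member `F` with
pinched measurable Jacobian, there is `τ₀ > 0` such that for EVERY `n ≥ 1`, `ε' > 0` with `nε' ≤ τ₀`,
`su2GibbsLaw S` is the ONLY invariant probability law of the reported `n`-step kernel with the half kick
`−(ε'/2)·Φ`. -/
theorem su2LeapfrogFTHMCN_invariant_unique_of_trajLength (hκ' : 0 < κ') (hΦ : Measurable Φ) (hΦ0 : 0 ≤ Φmax)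
    (hΦb : ∀ U l, ‖Φ U l‖ ≤ Φmax) (hKΦ0 : 0 ≤ KΦ) (hΦK : ∀ U U', ‖Φ U - Φ U'‖ ≤ KΦ * ‖coeConfig U - coeConfig U'‖)
    (hS : Measurable S) (hs : ∀ u, |S u| ≤ s)
    (hj₁ : 0 < j₁) (hJ₁ : ∀ v, j₁ ≤ J v) (hJ₂ : ∀ v, J v ≤ j₂) (hJm : Measurable J)
    (hF : HasJacobian (Measure.pi fun _ : ι => haarProbability (Matrix.specialUnitaryGroup (Fin 2) ℂ)) F
      fun v => ENNReal.ofReal (J v)) :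
    ∃ τ₀ : ℝ, 0 < τ₀ ∧ ∀ (n : ℕ) (ε' : ℝ) (_hn : 1 ≤ n) (_hε' : 0 < ε'), n * ε' ≤ τ₀ →
      ∀ (π' : Measure (ι → Matrix.specialUnitaryGroup (Fin 2) ℂ)) [IsProbabilityMeasure π'],
        Invariant (conjKernel (su2LeapfrogHMCN ε' κ' (measurable_halfKick_su2 hΦ ε')
          (fun v => S (F v) - Real.log (J v)) n) F) π' → π' = su2GibbsLaw S := by
  set s₀ := sunShortTrajThreshold pauliCoordι pauliCoordι_injective with hs₀
  have hs₀0 : 0 < s₀ := sunShortTrajThreshold_pos _ _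
  refine ⟨min s₀ (min (s₀ / (3 * Φmax + 1)) (Real.sqrt (s₀ / (KΦ + 1)))),
    lt_min hs₀0 (lt_min (by positivity) (Real.sqrt_pos.2 (by positivity))), fun n ε' hn hε' hτ π' _ hπ' => ?_⟩
  obtain ⟨h1, h2, h3⟩ := trajLength_threshold_arith hs₀0 hΦ0 hKΦ0 hn hε' rfl hτ
  refine su2LeapfrogFTHMCN_invariant_unique hε' hκ' hn (measurable_halfKick_su2 hΦ ε') (b := ε' / 2 * Φmax)
    (Kg := ε' / 2 * KΦ) (by positivity) (fun U l => ?_) (by positivity) (fun U U' => ?_) hS hs hj₁ hJ₁ hJ₂ hJm hF h1 h2 h3 hπ'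
  · rw [Pi.smul_apply, norm_smul, Real.norm_eq_abs, abs_neg, abs_of_pos (by positivity)]
    exact mul_le_mul_of_nonneg_left (hΦb U l) (by positivity)
  · have hsub : (-(ε' / 2)) • Φ U - (-(ε' / 2)) • Φ U' = (-(ε' / 2)) • (Φ U - Φ U') := by
      funext l; simp only [Pi.sub_apply, Pi.smul_apply, smul_sub]
    rw [hsub, norm_smul, Real.norm_eq_abs, abs_neg, abs_of_pos (by positivity), mul_assoc]
    exact mul_le_mul_of_nonneg_left (hΦK U U') (by positivity)

end UniqueTraj

/-! ## Any torus, any schedule -/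

section AnyTorus

variable {d L : ℕ} {X : Type*} [DecidableEq X] (χ : Site d L → X) [NeZero L]

set_option maxHeartbeats 400000 in -- RN-23 (7)(b): heavy declaration budgeted at source (lake build ≈ 10 % hungrier than the gate)
/-- **MULTI-STEP FT-HMC THROUGH THE `SU(2)` LO WILSON-FLOW MEMBER WITH THE EXACT FORCE AS RUN CONVERGES
TO THE WILSON MEASURE FROM EVERY START, BELOW A TRAJECTORY-LENGTH THRESHOLD.**  Proper colouring `χ`,
`2(d−1)|ε| < 1`, ANY schedule; every `β`, force scale `κ`, kinetic coefficient `κ' > 0`. -/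
theorem su2WilsonFlowLO_member_fthmcN_exactForce_uniformlyErgodic
    (hχ : ∀ (x : Site d L) (i : Fin d), χ (x.shift i) ≠ χ x) {ε : ℝ}
    (hε : |ε| * (2 * ((d - 1 : ℕ) : ℝ)) < 1) (sched : List (Fin d × X)) (β κ : ℝ) {κ' : ℝ} (hκ' : 0 < κ') :
    ∃ layers : List ((GaugeConfig d L (Matrix.specialUnitaryGroup (Fin 2) ℂ) ≃ᵐ GaugeConfig d L (Matrix.specialUnitaryGroup (Fin 2) ℂ)) × (GaugeConfig d L (Matrix.specialUnitaryGroup (Fin 2) ℂ) → ℝ)),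
      layers.map (fun Ly => ((Ly.1 : GaugeConfig d L (Matrix.specialUnitaryGroup (Fin 2) ℂ) → GaugeConfig d L (Matrix.specialUnitaryGroup (Fin 2) ℂ)), Ly.2)) =
        sched.map (fun s =>
        ((fun (V : GaugeConfig d L (Matrix.specialUnitaryGroup (Fin 2) ℂ)) (e : Edge d L) =>
        if e.2 = s.1 ∧ χ e.1 = s.2 then
          gaussUnit (geodesicKick ε (∑ ν ∈ Finset.univ.erase e.2,
            (vecQuat (((V (Site.shift e.1 e.2, ν) * (V (Site.shift e.1 ν, e.2))⁻¹ * (V (e.1, ν))⁻¹)⁻¹ : (Matrix.specialUnitaryGroup (Fin 2) ℂ)) : Matrix (Fin 2) (Fin 2) ℂ) +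
              vecQuat ((((V (Site.shift (e.1 - Pi.single ν 1) e.2, ν))⁻¹ * (V (e.1 - Pi.single ν 1, e.2))⁻¹ *
                V (e.1 - Pi.single ν 1, ν))⁻¹ : (Matrix.specialUnitaryGroup (Fin 2) ℂ)) : Matrix (Fin 2) (Fin 2) ℂ)))
            (vecQuat ((V e : (Matrix.specialUnitaryGroup (Fin 2) ℂ)) : Matrix (Fin 2) (Fin 2) ℂ)))
        else V e),
         fun V : GaugeConfig d L (Matrix.specialUnitaryGroup (Fin 2) ℂ) => ∏ a : {e : Edge d L // e.2 = s.1 ∧ χ e.1 = s.2},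
          (if Real.sin (angle (∑ ν ∈ Finset.univ.erase a.1.2,
            (vecQuat (((V (Site.shift a.1.1 a.1.2, ν) * (V (Site.shift a.1.1 ν, a.1.2))⁻¹ * (V (a.1.1, ν))⁻¹)⁻¹ : (Matrix.specialUnitaryGroup (Fin 2) ℂ)) : Matrix (Fin 2) (Fin 2) ℂ) +
              vecQuat ((((V (Site.shift (a.1.1 - Pi.single ν 1) a.1.2, ν))⁻¹ * (V (a.1.1 - Pi.single ν 1, a.1.2))⁻¹ *
                V (a.1.1 - Pi.single ν 1, ν))⁻¹ : (Matrix.specialUnitaryGroup (Fin 2) ℂ)) : Matrix (Fin 2) (Fin 2) ℂ))) (vecQuat ((V a.1 : (Matrix.specialUnitaryGroup (Fin 2) ℂ)) : Matrix (Fin 2) (Fin 2) ℂ))) = 0 then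
            (1 - ε * ‖(∑ ν ∈ Finset.univ.erase a.1.2,
            (vecQuat (((V (Site.shift a.1.1 a.1.2, ν) * (V (Site.shift a.1.1 ν, a.1.2))⁻¹ * (V (a.1.1, ν))⁻¹)⁻¹ : (Matrix.specialUnitaryGroup (Fin 2) ℂ)) : Matrix (Fin 2) (Fin 2) ℂ) +
              vecQuat ((((V (Site.shift (a.1.1 - Pi.single ν 1) a.1.2, ν))⁻¹ * (V (a.1.1 - Pi.single ν 1, a.1.2))⁻¹ *
                V (a.1.1 - Pi.single ν 1, ν))⁻¹ : (Matrix.specialUnitaryGroup (Fin 2) ℂ)) : Matrix (Fin 2) (Fin 2) ℂ)))‖ * Real.cos (angle (∑ ν ∈ Finset.univ.erase a.1.2,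
            (vecQuat (((V (Site.shift a.1.1 a.1.2, ν) * (V (Site.shift a.1.1 ν, a.1.2))⁻¹ * (V (a.1.1, ν))⁻¹)⁻¹ : (Matrix.specialUnitaryGroup (Fin 2) ℂ)) : Matrix (Fin 2) (Fin 2) ℂ) +
              vecQuat ((((V (Site.shift (a.1.1 - Pi.single ν 1) a.1.2, ν))⁻¹ * (V (a.1.1 - Pi.single ν 1, a.1.2))⁻¹ *
                V (a.1.1 - Pi.single ν 1, ν))⁻¹ : (Matrix.specialUnitaryGroup (Fin 2) ℂ)) : Matrix (Fin 2) (Fin 2) ℂ))) (vecQuat ((V a.1 : (Matrix.specialUnitaryGroup (Fin 2) ℂ)) : Matrix (Fin 2) (Fin 2) ℂ)))) ^ 3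
          else kickJac (ε * ‖(∑ ν ∈ Finset.univ.erase a.1.2,
            (vecQuat (((V (Site.shift a.1.1 a.1.2, ν) * (V (Site.shift a.1.1 ν, a.1.2))⁻¹ * (V (a.1.1, ν))⁻¹)⁻¹ : (Matrix.specialUnitaryGroup (Fin 2) ℂ)) : Matrix (Fin 2) (Fin 2) ℂ) +
              vecQuat ((((V (Site.shift (a.1.1 - Pi.single ν 1) a.1.2, ν))⁻¹ * (V (a.1.1 - Pi.single ν 1, a.1.2))⁻¹ *
                V (a.1.1 - Pi.single ν 1, ν))⁻¹ : (Matrix.specialUnitaryGroup (Fin 2) ℂ)) : Matrix (Fin 2) (Fin 2) ℂ)))‖) 2 (angle (∑ ν ∈ Finset.univ.erase a.1.2,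
            (vecQuat (((V (Site.shift a.1.1 a.1.2, ν) * (V (Site.shift a.1.1 ν, a.1.2))⁻¹ * (V (a.1.1, ν))⁻¹)⁻¹ : (Matrix.specialUnitaryGroup (Fin 2) ℂ)) : Matrix (Fin 2) (Fin 2) ℂ) +
              vecQuat ((((V (Site.shift (a.1.1 - Pi.single ν 1) a.1.2, ν))⁻¹ * (V (a.1.1 - Pi.single ν 1, a.1.2))⁻¹ *
                V (a.1.1 - Pi.single ν 1, ν))⁻¹ : (Matrix.specialUnitaryGroup (Fin 2) ℂ)) : Matrix (Fin 2) (Fin 2) ℂ))) (vecQuat ((V a.1 : (Matrix.specialUnitaryGroup (Fin 2) ℂ)) : Matrix (Fin 2) (Fin 2) ℂ)))))) ∧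
      ∃ hΦ : Measurable (fun (V : GaugeConfig d L (Matrix.specialUnitaryGroup (Fin 2) ℂ)) (l : Edge d L) => κ • WithLp.toLp 2 (fun i : Fin 3 =>
        fderiv ℝ (fun a : Edge d L → EuclideanSpace ℝ (Fin 3) => β * wilsonAction (Matrix.specialUnitaryGroup (Fin 2) ℂ).subtype ((layers.foldr (fun Ly (F : GaugeConfig d L (Matrix.specialUnitaryGroup (Fin 2) ℂ) ≃ᵐ GaugeConfig d L (Matrix.specialUnitaryGroup (Fin 2) ℂ)) => Ly.1.trans F) (MeasurableEquiv.refl (GaugeConfig d L (Matrix.specialUnitaryGroup (Fin 2) ℂ)))) ((fun l : Edge d L => expPauli (a l)) * V)) - Real.log ((layers.foldr (fun Ly K => fun v => Ly.2 v * K (Ly.1 v)) (fun _ => (1 : ℝ))) ((fun l : Edge d L => expPauli (a l)) * V))) 0 (Pi.single l (EuclideanSpace.single i (1 : ℝ))))),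
      ∃ τ₀ : ℝ, 0 < τ₀ ∧ ∀ (n : ℕ) (ε' : ℝ) (_hn : 1 ≤ n) (_hε' : 0 < ε'), n * ε' ≤ τ₀ →
        ∃ k : ℕ, ∃ δ : ℝ, 0 < δ ∧ δ ≤ 1 ∧ ∀ (μ₀ : Measure (GaugeConfig d L (Matrix.specialUnitaryGroup (Fin 2) ℂ))) [IsProbabilityMeasure μ₀] (t : ℕ) (A : Set (GaugeConfig d L (Matrix.specialUnitaryGroup (Fin 2) ℂ))),
          |((fun m : Measure (GaugeConfig d L (Matrix.specialUnitaryGroup (Fin 2) ℂ)) =>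
                m.bind (conjKernel (su2LeapfrogHMCN ε' κ' (measurable_halfKick_su2 hΦ ε')
                  (fun V : GaugeConfig d L (Matrix.specialUnitaryGroup (Fin 2) ℂ) => β * wilsonAction (Matrix.specialUnitaryGroup (Fin 2) ℂ).subtype ((layers.foldr (fun Ly (F : GaugeConfig d L (Matrix.specialUnitaryGroup (Fin 2) ℂ) ≃ᵐ GaugeConfig d L (Matrix.specialUnitaryGroup (Fin 2) ℂ)) => Ly.1.trans F) (MeasurableEquiv.refl (GaugeConfig d L (Matrix.specialUnitaryGroup (Fin 2) ℂ)))) V) - Real.log ((layers.foldr (fun Ly K => fun v => Ly.2 v * K (Ly.1 v)) (fun _ => (1 : ℝ))) V)) n) (layers.foldr (fun Ly (F : GaugeConfig d L (Matrix.specialUnitaryGroup (Fin 2) ℂ) ≃ᵐ GaugeConfig d L (Matrix.specialUnitaryGroup (Fin 2) ℂ)) => Ly.1.trans F) (MeasurableEquiv.refl (GaugeConfig d L (Matrix.specialUnitaryGroup (Fin 2) ℂ))))))^[t] μ₀).real A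
            - (wilsonMeasure (Matrix.specialUnitaryGroup (Fin 2) ℂ).subtype β).real A| ≤ (1 - δ) ^ (t / (k + 1)) := by
  obtain ⟨layers, hmap, hpos, hfmeas, hfjac, hfold⟩ := su2WilsonFlowLO_member_package χ hχ hε sched
  refine ⟨layers, hmap, ?_⟩
  obtain ⟨hΦm, Φmax, KΦ, hΦ0, hK0, hb, hK⟩ := su2WilsonFlowLO_exactForce_regular χ ε sched layers hmap hpos β κ
  refine ⟨hΦm, ?_⟩
  have hm : 0 < 1 - |ε| * (2 * ((d - 1 : ℕ) : ℝ)) := by linarith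
  have hρ : Continuous ⇑((Matrix.specialUnitaryGroup (Fin 2) ℂ).subtype) := continuous_subtype_val
  have hSc : Continuous fun U : GaugeConfig d L (Matrix.specialUnitaryGroup (Fin 2) ℂ) => β * wilsonAction (Matrix.specialUnitaryGroup (Fin 2) ℂ).subtype U :=
    continuous_smul_wilsonAction _ hρ β
  obtain ⟨s, hs⟩ := exists_bound_smul_wilsonAction (d := d) (L := L) (Matrix.specialUnitaryGroup (Fin 2) ℂ).subtype hρ β
  obtain ⟨τ₀, hτ₀, hconv⟩ := su2LeapfrogFTHMCN_uniformlyErgodic_of_trajLength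
    (S := fun U : GaugeConfig d L (Matrix.specialUnitaryGroup (Fin 2) ℂ) => β * wilsonAction (Matrix.specialUnitaryGroup (Fin 2) ℂ).subtype U) hκ' hΦm hΦ0 hb hK0 hK hSc.measurable hs
    (pow_pos (pow_pos hm _) _) (fun v => (hfold v).1) (fun v => (hfold v).2) hfmeas hfjac
  refine ⟨τ₀, hτ₀, fun n ε' hn hε' hτ => ?_⟩
  obtain ⟨k, δ, hδ0, hδ1, hbound⟩ := hconv n ε' hn hε' hτ
  refine ⟨k, δ, hδ0, hδ1, fun μ₀ _ t A => ?_⟩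
  rw [← su2GibbsLaw_eq_wilsonMeasure (d := d) (L := L) (Matrix.specialUnitaryGroup (Fin 2) ℂ).subtype β]
  exact hbound μ₀ t A

set_option maxHeartbeats 400000 in -- RN-23 (7)(b): heavy declaration budgeted at source (lake build ≈ 10 % hungrier than the gate)
/-- **… and the Wilson measure is the UNIQUE invariant probability law** of that reported `n`-step kernel,
for every `n ≥ 1`, `ε' > 0` below a trajectory-length threshold (same setting). -/
theorem wilsonMeasure_unique_invariant_su2WilsonFlowLO_member_fthmcN_exactForce
    (hχ : ∀ (x : Site d L) (i : Fin d), χ (x.shift i) ≠ χ x) {ε : ℝ}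
    (hε : |ε| * (2 * ((d - 1 : ℕ) : ℝ)) < 1) (sched : List (Fin d × X)) (β κ : ℝ) {κ' : ℝ} (hκ' : 0 < κ') :
    ∃ layers : List ((GaugeConfig d L (Matrix.specialUnitaryGroup (Fin 2) ℂ) ≃ᵐ GaugeConfig d L (Matrix.specialUnitaryGroup (Fin 2) ℂ)) × (GaugeConfig d L (Matrix.specialUnitaryGroup (Fin 2) ℂ) → ℝ)),
      layers.map (fun Ly => ((Ly.1 : GaugeConfig d L (Matrix.specialUnitaryGroup (Fin 2) ℂ) → GaugeConfig d L (Matrix.specialUnitaryGroup (Fin 2) ℂ)), Ly.2)) =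
        sched.map (fun s =>
        ((fun (V : GaugeConfig d L (Matrix.specialUnitaryGroup (Fin 2) ℂ)) (e : Edge d L) =>
        if e.2 = s.1 ∧ χ e.1 = s.2 then
          gaussUnit (geodesicKick ε (∑ ν ∈ Finset.univ.erase e.2,
            (vecQuat (((V (Site.shift e.1 e.2, ν) * (V (Site.shift e.1 ν, e.2))⁻¹ * (V (e.1, ν))⁻¹)⁻¹ : (Matrix.specialUnitaryGroup (Fin 2) ℂ)) : Matrix (Fin 2) (Fin 2) ℂ) +
              vecQuat ((((V (Site.shift (e.1 - Pi.single ν 1) e.2, ν))⁻¹ * (V (e.1 - Pi.single ν 1, e.2))⁻¹ *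
                V (e.1 - Pi.single ν 1, ν))⁻¹ : (Matrix.specialUnitaryGroup (Fin 2) ℂ)) : Matrix (Fin 2) (Fin 2) ℂ)))
            (vecQuat ((V e : (Matrix.specialUnitaryGroup (Fin 2) ℂ)) : Matrix (Fin 2) (Fin 2) ℂ)))
        else V e),
         fun V : GaugeConfig d L (Matrix.specialUnitaryGroup (Fin 2) ℂ) => ∏ a : {e : Edge d L // e.2 = s.1 ∧ χ e.1 = s.2},
          (if Real.sin (angle (∑ ν ∈ Finset.univ.erase a.1.2,
            (vecQuat (((V (Site.shift a.1.1 a.1.2, ν) * (V (Site.shift a.1.1 ν, a.1.2))⁻¹ * (V (a.1.1, ν))⁻¹)⁻¹ : (Matrix.specialUnitaryGroup (Fin 2) ℂ)) : Matrix (Fin 2) (Fin 2) ℂ) +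
              vecQuat ((((V (Site.shift (a.1.1 - Pi.single ν 1) a.1.2, ν))⁻¹ * (V (a.1.1 - Pi.single ν 1, a.1.2))⁻¹ *
                V (a.1.1 - Pi.single ν 1, ν))⁻¹ : (Matrix.specialUnitaryGroup (Fin 2) ℂ)) : Matrix (Fin 2) (Fin 2) ℂ))) (vecQuat ((V a.1 : (Matrix.specialUnitaryGroup (Fin 2) ℂ)) : Matrix (Fin 2) (Fin 2) ℂ))) = 0 then
            (1 - ε * ‖(∑ ν ∈ Finset.univ.erase a.1.2,
            (vecQuat (((V (Site.shift a.1.1 a.1.2, ν) * (V (Site.shift a.1.1 ν, a.1.2))⁻¹ * (V (a.1.1, ν))⁻¹)⁻¹ : (Matrix.specialUnitaryGroup (Fin 2) ℂ)) : Matrix (Fin 2) (Fin 2) ℂ) +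
              vecQuat ((((V (Site.shift (a.1.1 - Pi.single ν 1) a.1.2, ν))⁻¹ * (V (a.1.1 - Pi.single ν 1, a.1.2))⁻¹ *
                V (a.1.1 - Pi.single ν 1, ν))⁻¹ : (Matrix.specialUnitaryGroup (Fin 2) ℂ)) : Matrix (Fin 2) (Fin 2) ℂ)))‖ * Real.cos (angle (∑ ν ∈ Finset.univ.erase a.1.2,
            (vecQuat (((V (Site.shift a.1.1 a.1.2, ν) * (V (Site.shift a.1.1 ν, a.1.2))⁻¹ * (V (a.1.1, ν))⁻¹)⁻¹ : (Matrix.specialUnitaryGroup (Fin 2) ℂ)) : Matrix (Fin 2) (Fin 2) ℂ) +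
              vecQuat ((((V (Site.shift (a.1.1 - Pi.single ν 1) a.1.2, ν))⁻¹ * (V (a.1.1 - Pi.single ν 1, a.1.2))⁻¹ *
                V (a.1.1 - Pi.single ν 1, ν))⁻¹ : (Matrix.specialUnitaryGroup (Fin 2) ℂ)) : Matrix (Fin 2) (Fin 2) ℂ))) (vecQuat ((V a.1 : (Matrix.specialUnitaryGroup (Fin 2) ℂ)) : Matrix (Fin 2) (Fin 2) ℂ)))) ^ 3
          else kickJac (ε * ‖(∑ ν ∈ Finset.univ.erase a.1.2,
            (vecQuat (((V (Site.shift a.1.1 a.1.2, ν) * (V (Site.shift a.1.1 ν, a.1.2))⁻¹ * (V (a.1.1, ν))⁻¹)⁻¹ : (Matrix.specialUnitaryGroup (Fin 2) ℂ)) : Matrix (Fin 2) (Fin 2) ℂ) +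
              vecQuat ((((V (Site.shift (a.1.1 - Pi.single ν 1) a.1.2, ν))⁻¹ * (V (a.1.1 - Pi.single ν 1, a.1.2))⁻¹ *
                V (a.1.1 - Pi.single ν 1, ν))⁻¹ : (Matrix.specialUnitaryGroup (Fin 2) ℂ)) : Matrix (Fin 2) (Fin 2) ℂ)))‖) 2 (angle (∑ ν ∈ Finset.univ.erase a.1.2,
            (vecQuat (((V (Site.shift a.1.1 a.1.2, ν) * (V (Site.shift a.1.1 ν, a.1.2))⁻¹ * (V (a.1.1, ν))⁻¹)⁻¹ : (Matrix.specialUnitaryGroup (Fin 2) ℂ)) : Matrix (Fin 2) (Fin 2) ℂ) +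
              vecQuat ((((V (Site.shift (a.1.1 - Pi.single ν 1) a.1.2, ν))⁻¹ * (V (a.1.1 - Pi.single ν 1, a.1.2))⁻¹ *
                V (a.1.1 - Pi.single ν 1, ν))⁻¹ : (Matrix.specialUnitaryGroup (Fin 2) ℂ)) : Matrix (Fin 2) (Fin 2) ℂ))) (vecQuat ((V a.1 : (Matrix.specialUnitaryGroup (Fin 2) ℂ)) : Matrix (Fin 2) (Fin 2) ℂ)))))) ∧
      ∃ hΦ : Measurable (fun (V : GaugeConfig d L (Matrix.specialUnitaryGroup (Fin 2) ℂ)) (l : Edge d L) => κ • WithLp.toLp 2 (fun i : Fin 3 =>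
        fderiv ℝ (fun a : Edge d L → EuclideanSpace ℝ (Fin 3) => β * wilsonAction (Matrix.specialUnitaryGroup (Fin 2) ℂ).subtype ((layers.foldr (fun Ly (F : GaugeConfig d L (Matrix.specialUnitaryGroup (Fin 2) ℂ) ≃ᵐ GaugeConfig d L (Matrix.specialUnitaryGroup (Fin 2) ℂ)) => Ly.1.trans F) (MeasurableEquiv.refl (GaugeConfig d L (Matrix.specialUnitaryGroup (Fin 2) ℂ)))) ((fun l : Edge d L => expPauli (a l)) * V)) - Real.log ((layers.foldr (fun Ly K => fun v => Ly.2 v * K (Ly.1 v)) (fun _ => (1 : ℝ))) ((fun l : Edge d L => expPauli (a l)) * V))) 0 (Pi.single l (EuclideanSpace.single i (1 : ℝ))))),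
      ∃ τ₀ : ℝ, 0 < τ₀ ∧ ∀ (n : ℕ) (ε' : ℝ) (_hn : 1 ≤ n) (_hε' : 0 < ε'), n * ε' ≤ τ₀ →
        ∀ (π' : Measure (GaugeConfig d L (Matrix.specialUnitaryGroup (Fin 2) ℂ))) [IsProbabilityMeasure π'],
          Invariant (conjKernel (su2LeapfrogHMCN ε' κ' (measurable_halfKick_su2 hΦ ε')
            (fun V : GaugeConfig d L (Matrix.specialUnitaryGroup (Fin 2) ℂ) => β * wilsonAction (Matrix.specialUnitaryGroup (Fin 2) ℂ).subtype ((layers.foldr (fun Ly (F : GaugeConfig d L (Matrix.specialUnitaryGroup (Fin 2) ℂ) ≃ᵐ GaugeConfig d L (Matrix.specialUnitaryGroup (Fin 2) ℂ)) => Ly.1.trans F) (MeasurableEquiv.refl (GaugeConfig d L (Matrix.specialUnitaryGroup (Fin 2) ℂ)))) V) - Real.log ((layers.foldr (fun Ly K => fun v => Ly.2 v * K (Ly.1 v)) (fun _ => (1 : ℝ))) V)) n) (layers.foldr (fun Ly (F : GaugeConfig d L (Matrix.specialUnitaryGroup (Fin 2) ℂ) ≃ᵐ GaugeConfig d L (Matrix.specialUnitaryGroup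 (Fin 2) ℂ)) => Ly.1.trans F) (MeasurableEquiv.refl (GaugeConfig d L (Matrix.specialUnitaryGroup (Fin 2) ℂ))))) π' →
          π' = wilsonMeasure (Matrix.specialUnitaryGroup (Fin 2) ℂ).subtype β := by
  obtain ⟨layers, hmap, hpos, hfmeas, hfjac, hfold⟩ := su2WilsonFlowLO_member_package χ hχ hε sched
  refine ⟨layers, hmap, ?_⟩
  obtain ⟨hΦm, Φmax, KΦ, hΦ0, hK0, hb, hK⟩ := su2WilsonFlowLO_exactForce_regular χ ε sched layers hmap hpos β κ
  refine ⟨hΦm, ?_⟩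
  have hm : 0 < 1 - |ε| * (2 * ((d - 1 : ℕ) : ℝ)) := by linarith
  have hρ : Continuous ⇑((Matrix.specialUnitaryGroup (Fin 2) ℂ).subtype) := continuous_subtype_val
  have hSc : Continuous fun U : GaugeConfig d L (Matrix.specialUnitaryGroup (Fin 2) ℂ) => β * wilsonAction (Matrix.specialUnitaryGroup (Fin 2) ℂ).subtype U :=
    continuous_smul_wilsonAction _ hρ β
  obtain ⟨s, hs⟩ := exists_bound_smul_wilsonAction (d := d) (L := L) (Matrix.specialUnitaryGroup (Fin 2) ℂ).subtype hρ β
  obtain ⟨τ₀, hτ₀, huniq⟩ := su2LeapfrogFTHMCN_invariant_unique_of_trajLength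
    (S := fun U : GaugeConfig d L (Matrix.specialUnitaryGroup (Fin 2) ℂ) => β * wilsonAction (Matrix.specialUnitaryGroup (Fin 2) ℂ).subtype U) hκ' hΦm hΦ0 hb hK0 hK hSc.measurable hs
    (pow_pos (pow_pos hm _) _) (fun v => (hfold v).1) (fun v => (hfold v).2) hfmeas hfjac
  refine ⟨τ₀, hτ₀, fun n ε' hn hε' hτ π' _ hπ' => ?_⟩
  rw [← su2GibbsLaw_eq_wilsonMeasure (d := d) (L := L) (Matrix.specialUnitaryGroup (Fin 2) ℂ).subtype β]
  exact huniq n ε' hn hε' hτ π' hπ'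

end AnyTorus

/-! ## The row's acceptance configuration: 4⁴ `SU(2)`, parity masks, Lüscher's schedule -/

section Acceptance

set_option maxHeartbeats 400000 in -- RN-23 (7)(b): heavy declaration budgeted at source (lake build ≈ 10 % hungrier than the gate)
/-- **THE ROW'S ACCEPTANCE CONFIGURATION WITH THE EXACT FORCE AS RUN, MULTI-STEP**: 4⁴ `SU(2)`, a
parity colouring `χ`, Lüscher's sweep schedule (`8·nsweeps` masked LO Wilson-flow sub-steps, formulas
VERBATIM), refusal rule `6|ε| < 1`; every `β`, `κ`, `κ' > 0`: the exact force through the member is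
measurable and there is `τ₀ > 0` such that every `n ≥ 1`, `ε' > 0` with `nε' ≤ τ₀` give a reported
`n`-step FT-HMC chain converging to the Wilson measure from EVERY start geometrically in total
variation. -/
theorem su2_fthmcN_acceptanceLattice_exactForce_uniformlyErgodic {ε : ℝ} (hε : |ε| * 6 < 1)
    (nsweeps : ℕ) (β κ : ℝ) {κ' : ℝ} (hκ' : 0 < κ') :
    ∃ χ : Site 4 4 → ZMod 2, (∀ (x : Site 4 4) (i : Fin 4), χ (x.shift i) ≠ χ x) ∧
    ∃ layers : List ((GaugeConfig 4 4 (Matrix.specialUnitaryGroup (Fin 2) ℂ) ≃ᵐ GaugeConfig 4 4 (Matrix.specialUnitaryGroup (Fin 2) ℂ)) × (GaugeConfig 4 4 (Matrix.specialUnitaryGroup (Fin 2) ℂ) → ℝ)),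
      layers.map (fun Ly => ((Ly.1 : GaugeConfig 4 4 (Matrix.specialUnitaryGroup (Fin 2) ℂ) → GaugeConfig 4 4 (Matrix.specialUnitaryGroup (Fin 2) ℂ)), Ly.2)) =
        ((List.replicate nsweeps ((List.finRange 4).flatMap fun μ : Fin 4 => [(μ, (0 : ZMod 2)), (μ, 1)])).flatten).map (fun s =>
        ((fun (V : GaugeConfig 4 4 (Matrix.specialUnitaryGroup (Fin 2) ℂ)) (e : Edge 4 4) =>
        if e.2 = s.1 ∧ χ e.1 = s.2 then
          gaussUnit (geodesicKick ε (∑ ν ∈ Finset.univ.erase e.2,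
            (vecQuat (((V (Site.shift e.1 e.2, ν) * (V (Site.shift e.1 ν, e.2))⁻¹ * (V (e.1, ν))⁻¹)⁻¹ : (Matrix.specialUnitaryGroup (Fin 2) ℂ)) : Matrix (Fin 2) (Fin 2) ℂ) +
              vecQuat ((((V (Site.shift (e.1 - Pi.single ν 1) e.2, ν))⁻¹ * (V (e.1 - Pi.single ν 1, e.2))⁻¹ *
                V (e.1 - Pi.single ν 1, ν))⁻¹ : (Matrix.specialUnitaryGroup (Fin 2) ℂ)) : Matrix (Fin 2) (Fin 2) ℂ)))
            (vecQuat ((V e : (Matrix.specialUnitaryGroup (Fin 2) ℂ)) : Matrix (Fin 2) (Fin 2) ℂ)))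
        else V e),
         fun V : GaugeConfig 4 4 (Matrix.specialUnitaryGroup (Fin 2) ℂ) => ∏ a : {e : Edge 4 4 // e.2 = s.1 ∧ χ e.1 = s.2},
          (if Real.sin (angle (∑ ν ∈ Finset.univ.erase a.1.2,
            (vecQuat (((V (Site.shift a.1.1 a.1.2, ν) * (V (Site.shift a.1.1 ν, a.1.2))⁻¹ * (V (a.1.1, ν))⁻¹)⁻¹ : (Matrix.specialUnitaryGroup (Fin 2) ℂ)) : Matrix (Fin 2) (Fin 2) ℂ) +
              vecQuat ((((V (Site.shift (a.1.1 - Pi.single ν 1) a.1.2, ν))⁻¹ * (V (a.1.1 - Pi.single ν 1, a.1.2))⁻¹ *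
                V (a.1.1 - Pi.single ν 1, ν))⁻¹ : (Matrix.specialUnitaryGroup (Fin 2) ℂ)) : Matrix (Fin 2) (Fin 2) ℂ))) (vecQuat ((V a.1 : (Matrix.specialUnitaryGroup (Fin 2) ℂ)) : Matrix (Fin 2) (Fin 2) ℂ))) = 0 then
            (1 - ε * ‖(∑ ν ∈ Finset.univ.erase a.1.2,
            (vecQuat (((V (Site.shift a.1.1 a.1.2, ν) * (V (Site.shift a.1.1 ν, a.1.2))⁻¹ * (V (a.1.1, ν))⁻¹)⁻¹ : (Matrix.specialUnitaryGroup (Fin 2) ℂ)) : Matrix (Fin 2) (Fin 2) ℂ) +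
              vecQuat ((((V (Site.shift (a.1.1 - Pi.single ν 1) a.1.2, ν))⁻¹ * (V (a.1.1 - Pi.single ν 1, a.1.2))⁻¹ *
                V (a.1.1 - Pi.single ν 1, ν))⁻¹ : (Matrix.specialUnitaryGroup (Fin 2) ℂ)) : Matrix (Fin 2) (Fin 2) ℂ)))‖ * Real.cos (angle (∑ ν ∈ Finset.univ.erase a.1.2,
            (vecQuat (((V (Site.shift a.1.1 a.1.2, ν) * (V (Site.shift a.1.1 ν, a.1.2))⁻¹ * (V (a.1.1, ν))⁻¹)⁻¹ : (Matrix.specialUnitaryGroup (Fin 2) ℂ)) : Matrix (Fin 2) (Fin 2) ℂ) +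
              vecQuat ((((V (Site.shift (a.1.1 - Pi.single ν 1) a.1.2, ν))⁻¹ * (V (a.1.1 - Pi.single ν 1, a.1.2))⁻¹ *
                V (a.1.1 - Pi.single ν 1, ν))⁻¹ : (Matrix.specialUnitaryGroup (Fin 2) ℂ)) : Matrix (Fin 2) (Fin 2) ℂ))) (vecQuat ((V a.1 : (Matrix.specialUnitaryGroup (Fin 2) ℂ)) : Matrix (Fin 2) (Fin 2) ℂ)))) ^ 3
          else kickJac (ε * ‖(∑ ν ∈ Finset.univ.erase a.1.2,
            (vecQuat (((V (Site.shift a.1.1 a.1.2, ν) * (V (Site.shift a.1.1 ν, a.1.2))⁻¹ * (V (a.1.1, ν))⁻¹)⁻¹ : (Matrix.specialUnitaryGroup (Fin 2) ℂ)) : Matrix (Fin 2) (Fin 2) ℂ) +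
              vecQuat ((((V (Site.shift (a.1.1 - Pi.single ν 1) a.1.2, ν))⁻¹ * (V (a.1.1 - Pi.single ν 1, a.1.2))⁻¹ *
                V (a.1.1 - Pi.single ν 1, ν))⁻¹ : (Matrix.specialUnitaryGroup (Fin 2) ℂ)) : Matrix (Fin 2) (Fin 2) ℂ)))‖) 2 (angle (∑ ν ∈ Finset.univ.erase a.1.2,
            (vecQuat (((V (Site.shift a.1.1 a.1.2, ν) * (V (Site.shift a.1.1 ν, a.1.2))⁻¹ * (V (a.1.1, ν))⁻¹)⁻¹ : (Matrix.specialUnitaryGroup (Fin 2) ℂ)) : Matrix (Fin 2) (Fin 2) ℂ) +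
              vecQuat ((((V (Site.shift (a.1.1 - Pi.single ν 1) a.1.2, ν))⁻¹ * (V (a.1.1 - Pi.single ν 1, a.1.2))⁻¹ *
                V (a.1.1 - Pi.single ν 1, ν))⁻¹ : (Matrix.specialUnitaryGroup (Fin 2) ℂ)) : Matrix (Fin 2) (Fin 2) ℂ))) (vecQuat ((V a.1 : (Matrix.specialUnitaryGroup (Fin 2) ℂ)) : Matrix (Fin 2) (Fin 2) ℂ)))))) ∧
      layers.length = 8 * nsweeps ∧
      ∃ hΦ : Measurable (fun (V : GaugeConfig 4 4 (Matrix.specialUnitaryGroup (Fin 2) ℂ)) (l : Edge 4 4) => κ • WithLp.toLp 2 (fun i : Fin 3 =>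
        fderiv ℝ (fun a : Edge 4 4 → EuclideanSpace ℝ (Fin 3) => β * wilsonAction (Matrix.specialUnitaryGroup (Fin 2) ℂ).subtype ((layers.foldr (fun Ly (F : GaugeConfig 4 4 (Matrix.specialUnitaryGroup (Fin 2) ℂ) ≃ᵐ GaugeConfig 4 4 (Matrix.specialUnitaryGroup (Fin 2) ℂ)) => Ly.1.trans F) (MeasurableEquiv.refl (GaugeConfig 4 4 (Matrix.specialUnitaryGroup (Fin 2) ℂ)))) ((fun l : Edge 4 4 => expPauli (a l)) * V)) - Real.log ((layers.foldr (fun Ly K => fun v => Ly.2 v * K (Ly.1 v)) (fun _ => (1 : ℝ))) ((fun l : Edge 4 4 => expPauli (a l)) * V))) 0 (Pi.single l (EuclideanSpace.single i (1 : ℝ))))),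
      ∃ τ₀ : ℝ, 0 < τ₀ ∧ ∀ (n : ℕ) (ε' : ℝ) (_hn : 1 ≤ n) (_hε' : 0 < ε'), n * ε' ≤ τ₀ →
        ∃ k : ℕ, ∃ δ : ℝ, 0 < δ ∧ δ ≤ 1 ∧ ∀ (μ₀ : Measure (GaugeConfig 4 4 (Matrix.specialUnitaryGroup (Fin 2) ℂ))) [IsProbabilityMeasure μ₀] (t : ℕ) (A : Set (GaugeConfig 4 4 (Matrix.specialUnitaryGroup (Fin 2) ℂ))),
          |((fun m : Measure (GaugeConfig 4 4 (Matrix.specialUnitaryGroup (Fin 2) ℂ)) =>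
                m.bind (conjKernel (su2LeapfrogHMCN ε' κ' (measurable_halfKick_su2 hΦ ε')
                  (fun V : GaugeConfig 4 4 (Matrix.specialUnitaryGroup (Fin 2) ℂ) => β * wilsonAction (Matrix.specialUnitaryGroup (Fin 2) ℂ).subtype ((layers.foldr (fun Ly (F : GaugeConfig 4 4 (Matrix.specialUnitaryGroup (Fin 2) ℂ) ≃ᵐ GaugeConfig 4 4 (Matrix.specialUnitaryGroup (Fin 2) ℂ)) => Ly.1.trans F) (MeasurableEquiv.refl (GaugeConfig 4 4 (Matrix.specialUnitaryGroup (Fin 2) ℂ)))) V) - Real.log ((layers.foldr (fun Ly K => fun v => Ly.2 v * K (Ly.1 v)) (fun _ => (1 : ℝ))) V)) n) (layers.foldr (fun Ly (F : GaugeConfig 4 4 (Matrix.specialUnitaryGroup (Fin 2) ℂ) ≃ᵐ GaugeConfig 4 4 (Matrix.specialUnitaryGroup (Fin 2) ℂ)) => Ly.1.trans F) (MeasurableEquiv.refl (GaugeConfig 4 4 (Matrix.specialUnitaryGroup (Fin 2) ℂ))))))^[t] μ₀).real A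
            - (wilsonMeasure (Matrix.specialUnitaryGroup (Fin 2) ℂ).subtype β).real A| ≤ (1 - δ) ^ (t / (k + 1)) := by
  obtain ⟨χ, hχ⟩ := exists_parityMask (d := 4) (L := 4) (by decide)
  have hε' : |ε| * (2 * ((4 - 1 : ℕ) : ℝ)) < 1 := by norm_num; linarith
  obtain ⟨layers, hmap, hrest⟩ := su2WilsonFlowLO_member_fthmcN_exactForce_uniformlyErgodic χ hχ hε'
    ((List.replicate nsweeps ((List.finRange 4).flatMap fun μ : Fin 4 => [(μ, (0 : ZMod 2)), (μ, 1)])).flatten) β κ hκ'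
  refine ⟨χ, hχ, layers, hmap, ?_, hrest⟩
  have h := congrArg List.length hmap
  rw [List.length_map, List.length_map, length_luscherSchedule_four] at h
  exact h

end Acceptance

end Summit.Ventures.LatticeQCDFlow.Exactness
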